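import Summits.BirchSwinnertonDyer.BirchSwinnertonDyer.Theorems.RamifiedSevenEllipticUnitsEllipticUnitValueSevenStubLocalMordellWeilDictSeven
import Summits.BirchSwinnertonDyer.BirchSwinnertonDyer.Theorems.RamifiedSevenEllipticUnitsKummerChartInj
import Summits.BirchSwinnertonDyer.Rank1Residual.X12.O11.RamifiedRubinFormulaLineZp
import HarnessLib

/-!
# K7r value line after E-Zp (crux `EllipticUnitValueSevenOfGZK`, line `rubin-formula-zp`), stub S_dict′:
# THE LOCAL MORDELL–WEIL DICTIONARY WITH INJECTIVITY, `X12.O11.RamifiedCMLocalMordellWeilDictAtZp W p`,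
# IS A THEOREM AT EVERY O11 FRAME; the registered stub `stub_localMordellWeilDictSevenZp` of item
# stmt-BirchSwinnertonDyer-19945 (cell `bsd-cm`, seat `bsd-cm-k7r-c3` g6; `--supports` 19945)

HONEST FRAMING. This proves the typed stub S_dict′ of the re-cut K7r value line
(`Rank1Residual/X12/O11/RamifiedRubinFormulaLineZp.lean`, seat k7r-c4 g5, planner D117): the dictionary
`m_loc = n + n'` (already `ramifiedCMLocalMordellWeilDictAt_holds`) AND the injectivity (inj) of the
localisation `loc_𝔭` on the global Mordell–Weil Kummer span modulo torsion:

  `∀ x ∈ E(K) ⊗ ℤ_p` (the tree's `mordellWeilKummerSpan p Γ_K`), `loc_𝔭 x` torsion `→ x` torsion.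

Nothing is asserted about the crux (the ramified Rubin formula, S_open, stays OPEN); BSD is not proved by
any of this; a closed item closes a rung leaf of BirchSwinnertonDyer at most.

PROOF of (inj) at a frame (`ramifiedCMLocalMordellWeilDictAtZp_holds`, every prime): with the chart
`Φ : E(K_𝔭) → ℤ_p × ℤ_p` of `RamifiedSevenEllipticUnitsKummerFrameChart.lean` (values (V1)–(V3)) and
`RamifiedSevenEllipticUnitsKummerChartInj.lean`: (a) `loc_𝔭 x ∈ E(K_𝔭) ⊗ ℤ_p`, which is torsion-free, so
`loc_𝔭 x = 0`; (b) GLOBAL STRUCTURE: every `Q ∈ E(K)` has `2Q − kP − k'T` torsion for integers `k, k'`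
(`P` the generator of `E(ℚ)`, `T` the twist of the generator `P'` of `E'(ℚ)`; from (V1)–(V3), `ker Φ =`
torsion and the injectivity of `E(K) → E(K_𝔭)`), hence — the compact Kummer map being additive, killing
torsion (`E(K)[p] = 0`), and `ℤ_p`-compatible — every `x` in the span has `2x = α·κ(P) + β·κ(T)` with
`α, β ∈ ℤ_p` (closure induction); (c) applying `loc_𝔭` and the chart: `α Φ(P) + β Φ(T) = (α λP, β λ'P') = 0`,
so `α = β = 0` (`λP, λ'P' ≠ 0`), i.e. `2x = 0`. References: J. H. Silverman, *AEC* (2009) VIII.§2,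
Ex. 10.16, VII.6.3; B. Perrin-Riou, Bull. SMF 115 (1987) §0; cell line card `Lines/rubin-formula-zp.md`.
-/

set_option linter.dupNamespace false

noncomputable section

open scoped Classical

open WeierstrassCurve NumberField IsDedekindDomain Field
  Literature.NumberTheory.EllipticCurves Literature.NumberTheory.GaloisRepresentations
  Literature.NumberTheory.EllipticCurves.BurungaleKobayashiNakamuraOta2026
  Summit.BirchSwinnertonDyer.Rank1Residual

namespace Summit.BirchSwinnertonDyer.BirchSwinnertonDyer.Theorems.RamifiedSevenEllipticUnits

/-- **(inj) at an O11 frame: `loc_𝔭` is injective modulo torsion on the global Mordell–Weil Kummer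
span.** For a globally minimal `W/ℚ` with an O11 frame `(K, 𝔭, W', C)` at `p`, generators `P`, `P'` of
`W(ℚ)`, `W'(ℚ)` modulo torsion, and `H = Γ_K`: every `x ∈ E(K) ⊗ ℤ_p` (the tree's
`mordellWeilKummerSpan p H`) whose localisation `loc_𝔭 x` is torsion is itself torsion (module docstring,
steps (a)–(c)). [cite: SilvermanAEC2009, Exercise 10.16 and VIII.§2] [cite: PerrinRiou1987BSMF, §0 p. 401] -/
theorem mordellWeilKummerSpan_torsion_of_loc_torsion (W : WeierstrassCurve ℚ) [W.IsElliptic]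
    [W.IsGloballyMinimal] (p : ℕ) [Fact p.Prime] {K : Type} [Field K] [NumberField K]
    {𝔭 : HeightOneSpectrum (𝓞 K)} {W' : WeierstrassCurve ℚ} [W'.IsElliptic] [W'.IsGloballyMinimal]
    {C : VariableChange ℚ} (hF : X12.O11.IsFrame W p K 𝔭 W' C)
    {P : W.toAffine.Point} (hP : ¬ IsOfFinAddOrder P)
    (hgen : ∀ R : W.toAffine.Point, ∃ (k : ℤ) (T : W.toAffine.Point), IsOfFinAddOrder T ∧ R = k • P + T)
    {P' : W'.toAffine.Point} (hP' : ¬ IsOfFinAddOrder P')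
    (hgen' : ∀ R : W'.toAffine.Point, ∃ (k : ℤ) (T : W'.toAffine.Point),
      IsOfFinAddOrder T ∧ R = k • P' + T)
    (H : Subgroup (absoluteGaloisGroup K)) (hH : H = ⊤) :
    ∀ x ∈ (W.baseChange K).mordellWeilKummerSpan p H,
      (W.baseChange K).localTorsionResPi (closureEmb (K := K) (𝔭.adicCompletion K)) p H x ∈
        AddCommGroup.torsion (((W.baseChange K).baseChange (𝔭.adicCompletion K)).torsionH1Pi p
          (localSubgroupOfEmb H (closureEmb (K := K) (𝔭.adicCompletion K)))) →
      x ∈ AddCommGroup.torsion ((W.baseChange K).torsionH1Pi p H) := by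
  subst hH
  intro x hx hloc
  have hp : p.Prime := Fact.out
  -- the chart at the frame and its by-products
  obtain ⟨Φ, lam, lam', u, hΦ0, hΦs, hlam0, -, hlam'0, -, hu, hV1, hV2, hV3⟩ :=
    KummerCore.exists_frameChart W p hF
  haveI : NoZeroSMulDivisors ℤ_[p] (ℤ_[p] × ℤ_[p]) := KummerCore.noZeroSMulDivisors_prod_padicInt
  haveI : CharZero (𝔭.adicCompletion K) :=
    charZero_of_injective_algebraMap (algebraMap K (𝔭.adicCompletion K)).injective
  have hE := noPTorsion_adicCompletion_of_isFrame W p hF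
  obtain ⟨htf, hdet⟩ := KummerCore.localKummer_torsionFree_and_chart_detects (W.baseChange K)
    (closureEmb (K := K) (𝔭.adicCompletion K)) p Φ hΦ0 hΦs KummerCore.prod_padicInt_separated hE
  set bc : (W.baseChange K).toAffine.Point →+
      ((W.baseChange K).baseChange (𝔭.adicCompletion K)).toAffine.Point :=
    Affine.Point.baseChange (W' := W.baseChange K) K (𝔭.adicCompletion K) with hbc
  -- (a) `loc x = 0`
  have hxB : (W.baseChange K).localTorsionResPi (closureEmb (K := K) (𝔭.adicCompletion K)) p ⊤ x ∈
      (W.baseChange K).localKummerCompactOfEmb (closureEmb (K := K) (𝔭.adicCompletion K)) p ⊤ :=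
    (W.baseChange K).map_localTorsionResPi_mordellWeilKummerSpan_le _ p ⊤ ⟨x, hx, rfl⟩
  have hloc0 : (W.baseChange K).localTorsionResPi (closureEmb (K := K) (𝔭.adicCompletion K)) p ⊤ x = 0 := by
    have hmem := AddSubgroup.mem_inf.2 ⟨hloc, hxB⟩
    rwa [htf, AddSubgroup.mem_bot] at hmem
  -- the generators in the chart are non-zero
  have htorsP : ∀ T : W.toAffine.Point, IsOfFinAddOrder T → IsOfFinAddOrder (W.toPadicPoint p T) :=
    fun T hT ↦ (W.toPadicPoint p).isOfFinAddOrder hT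
  have htorsP' : ∀ T : W'.toAffine.Point, IsOfFinAddOrder T → IsOfFinAddOrder (W'.toPadicPoint p T) :=
    fun T hT ↦ (W'.toPadicPoint p).isOfFinAddOrder hT
  have hx₁ : lam (W.toPadicPoint p P) ≠ 0 := fun h ↦ hP
    (((Affine.Point.map_injective (W' := W) (Algebra.ofId ℚ ℚ_[p])).isOfFinAddOrder_iff
      (f := W.toPadicPoint p)).1 ((hlam0 _).1 h))
  have hx₂ : lam' (W'.toPadicPoint p P') ≠ 0 := fun h ↦ hP'
    (((Affine.Point.map_injective (W' := W') (Algebra.ofId ℚ ℚ_[p])).isOfFinAddOrder_iff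
      (f := W'.toPadicPoint p)).1 ((hlam'0 _).1 h))
  -- (b) the twist of `P'` and the point decomposition `2Q ≡ kP + k'T₂ (mod torsion)` in `E(K)`
  have hV1P := hV1 P
  set PK : (W.baseChange K).toAffine.Point := Affine.Point.baseChange (W' := W) ℚ K P with hPK
  obtain ⟨T₂, hT₂⟩ := hV2 P'
  have hbcinj : Function.Injective bc := Affine.Point.map_injective _
  have hdecomp : ∀ Q : (W.baseChange K).toAffine.Point, ∃ k k' : ℤ,
      IsOfFinAddOrder (2 • Q - k • PK - k' • T₂) := by
    intro Q
    obtain ⟨Q₀, Q₀', hQ⟩ := hV3 Q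
    obtain ⟨k, t, ht, hQ₀⟩ := hgen Q₀
    obtain ⟨k', t', ht', hQ₀'⟩ := hgen' Q₀'
    refine ⟨k, k', ?_⟩
    refine (hbcinj.isOfFinAddOrder_iff (f := bc)).1 ?_
    rw [← hΦ0]
    have hlamQ₀ : lam (W.toPadicPoint p Q₀) = k • lam (W.toPadicPoint p P) := by
      rw [hQ₀, map_add, map_add, map_zsmul, map_zsmul, (hlam0 _).2 (htorsP t ht), add_zero]
    have hlamQ₀' : lam' (W'.toPadicPoint p Q₀') = k' • lam' (W'.toPadicPoint p P') := by
      rw [hQ₀', map_add, map_add, map_zsmul, map_zsmul, (hlam'0 _).2 (htorsP' t' ht'), add_zero]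
    set g : (W.baseChange K).toAffine.Point →+ ℤ_[p] × ℤ_[p] := Φ.comp bc with hg
    have hgQ : g Q = (u * lam (W.toPadicPoint p Q₀), u * lam' (W'.toPadicPoint p Q₀')) := hQ
    have hgP : g PK = (lam (W.toPadicPoint p P), 0) := hV1P
    have hgT : g T₂ = (0, lam' (W'.toPadicPoint p P')) := hT₂
    change g (2 • Q - k • PK - k' • T₂) = 0
    rw [map_sub, map_sub, map_nsmul, map_zsmul, map_zsmul, hgQ, hgP, hgT, hlamQ₀, hlamQ₀']
    refine Prod.ext ?_ ?_
    · simp only [Prod.fst_sub, Prod.smul_fst, Prod.fst_zero]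
      simp only [zsmul_eq_mul, nsmul_eq_mul, Nat.cast_ofNat, mul_zero, sub_zero]
      linear_combination ((k : ℤ_[p]) * lam (W.toPadicPoint p P)) * hu
    · simp only [Prod.snd_sub, Prod.smul_snd, Prod.snd_zero]
      simp only [zsmul_eq_mul, nsmul_eq_mul, Nat.cast_ofNat, mul_zero, sub_zero]
      linear_combination ((k' : ℤ_[p]) * lam' (W'.toPadicPoint p P')) * hu
  -- the global Kummer data: the fixed points `M_K ≅ E(K)`, no `p`-torsion, `κ` kills torsion
  have hMK : ∀ m : (W.baseChange K).fixedGeomPoints ⊤, p • m = 0 → m = 0 := by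
    intro m hm
    obtain ⟨R, hR⟩ := KummerCore.exists_toGeomPoints_eq_of_mem_fixedGeomPoints_top' (W.baseChange K) m.2
    have hm' : toGeomPoints (W.baseChange K) (p • R) = 0 := by
      rw [map_nsmul, hR, ← AddSubgroupClass.coe_nsmul, hm, ZeroMemClass.coe_zero]
    have hR0 : p • R = 0 := toGeomPoints_injective _ (by rw [hm', map_zero])
    have hR0' : R = 0 := hbcinj (by rw [map_zero]; exact hE _ (by rw [← map_nsmul, hR0, map_zero]))
    exact Subtype.ext (by rw [← hR, hR0', map_zero, ZeroMemClass.coe_zero])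
  have hκK : ∀ (m : (W.baseChange K).fixedGeomPoints ⊤) (k : ℕ),
      (W.baseChange K).kummerFamilyHom p ⊤ m k = 0 ↔
        ∃ R : (W.baseChange K).fixedGeomPoints ⊤, ((p : ℤ) ^ k) • R = m := fun m k ↦ by
    rw [kummerFamilyHom_apply]
    exact (W.baseChange K).kummerFamily_apply_eq_zero_iff p ⊤ m k
  have hκtors : ∀ m : (W.baseChange K).fixedGeomPoints ⊤, IsOfFinAddOrder m →
      (W.baseChange K).kummerFamily p ⊤ m = 0 := fun m hm ↦ by
    rw [← kummerFamilyHom_apply]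
    exact KummerCore.kummer_eq_zero_of_isOfFinAddOrder _ hMK hκK hm
  -- the two global Kummer families `κ(P_K)`, `κ(T₂)`
  set mP : (W.baseChange K).fixedGeomPoints ⊤ :=
    ⟨toGeomPoints (W.baseChange K) PK, KummerCore.toGeomPoints_mem_fixedGeomPoints W ⊤ PK⟩ with hmP
  set mT : (W.baseChange K).fixedGeomPoints ⊤ :=
    ⟨toGeomPoints (W.baseChange K) T₂, KummerCore.toGeomPoints_mem_fixedGeomPoints W ⊤ T₂⟩ with hmT
  -- (b') every element of the span: `2 • y = α · κ(P_K) + β · κ(T₂)`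
  have key : ∀ y ∈ (W.baseChange K).mordellWeilKummerSpan p ⊤, ∃ α β : ℤ_[p],
      2 • y = (W.baseChange K).padicPi p ⊤ α ((W.baseChange K).kummerFamily p ⊤ mP) +
        (W.baseChange K).padicPi p ⊤ β ((W.baseChange K).kummerFamily p ⊤ mT) := by
    intro y hy
    unfold mordellWeilKummerSpan at hy
    rw [kummerSpan_eq_closure_kummerFamily] at hy
    induction hy using AddSubgroup.closure_induction with
    | mem y hy =>
      obtain ⟨Qg, hQS, c, rfl⟩ := hy
      obtain ⟨Q, hQ⟩ :=
        KummerCore.exists_toGeomPoints_eq_of_mem_fixedGeomPoints_top' (W.baseChange K) hQS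
      obtain ⟨k, k', hD⟩ := hdecomp Q
      set mD : (W.baseChange K).fixedGeomPoints ⊤ :=
        ⟨toGeomPoints (W.baseChange K) (2 • Q - k • PK - k' • T₂),
          KummerCore.toGeomPoints_mem_fixedGeomPoints W ⊤ _⟩ with hmD
      have hmDtors : IsOfFinAddOrder mD :=
        ((AddSubgroup.subtype_injective _).isOfFinAddOrder_iff
          (f := ((W.baseChange K).fixedGeomPoints ⊤).subtype)).1
          ((toGeomPoints (W.baseChange K)).isOfFinAddOrder hD)
      have hm2 : 2 • (⟨Qg, hQS⟩ : (W.baseChange K).fixedGeomPoints ⊤) = k • mP + k' • mT + mD := by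
        apply Subtype.ext
        simp only [AddSubgroupClass.coe_nsmul, AddSubgroupClass.coe_zsmul, AddSubgroup.coe_add, hmP, hmT,
          hmD, ← hQ, ← map_zsmul, ← map_nsmul, ← map_add]
        congr 1
        abel
      refine ⟨(k : ℤ_[p]) * c, (k' : ℤ_[p]) * c, ?_⟩
      rw [KummerCore.padicPi_intCast_mul_left_of_levelTorsion (KummerCore.levelTorsion_kummerFamily mP),
        KummerCore.padicPi_intCast_mul_left_of_levelTorsion (KummerCore.levelTorsion_kummerFamily mT),
        ← map_nsmul ((W.baseChange K).padicPi p ⊤ c), ← kummerFamilyHom_apply,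
        ← map_nsmul ((W.baseChange K).kummerFamilyHom p ⊤), hm2]
      simp only [map_add, map_zsmul, kummerFamilyHom_apply, hκtors mD hmDtors, add_zero]
    | zero =>
      exact ⟨0, 0, by rw [smul_zero, KummerCore.padicPi_zero_left, KummerCore.padicPi_zero_left,
        add_zero]⟩
    | add y z _ _ hy hz =>
      obtain ⟨α₁, β₁, h₁⟩ := hy
      obtain ⟨α₂, β₂, h₂⟩ := hz
      refine ⟨α₁ + α₂, β₁ + β₂, ?_⟩
      rw [smul_add, h₁, h₂, KummerCore.padicPi_add_left_of_levelTorsion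
        (KummerCore.levelTorsion_kummerFamily mP), KummerCore.padicPi_add_left_of_levelTorsion
        (KummerCore.levelTorsion_kummerFamily mT)]
      abel
    | neg y _ hy =>
      obtain ⟨α, β, h⟩ := hy
      refine ⟨-α, -β, ?_⟩
      rw [smul_neg, h, KummerCore.padicPi_neg_left_of_levelTorsion
        (KummerCore.levelTorsion_kummerFamily mP), KummerCore.padicPi_neg_left_of_levelTorsion
        (KummerCore.levelTorsion_kummerFamily mT)]
      abel
  -- (c) localise `2 • x = α · κ(P_K) + β · κ(T₂)` and read it in the chart
  obtain ⟨α, β, h2x⟩ := key x hx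
  have hlocfam : ∀ R : (W.baseChange K).toAffine.Point,
      (W.baseChange K).localTorsionResPi (closureEmb (K := K) (𝔭.adicCompletion K)) p ⊤
        ((W.baseChange K).kummerFamily p ⊤
          ⟨toGeomPoints (W.baseChange K) R, KummerCore.toGeomPoints_mem_fixedGeomPoints W ⊤ R⟩) =
      ((W.baseChange K).baseChange (𝔭.adicCompletion K)).kummerFamily p
        (localSubgroupOfEmb ⊤ (closureEmb (K := K) (𝔭.adicCompletion K)))
        ⟨toGeomPoints ((W.baseChange K).baseChange (𝔭.adicCompletion K)) (bc R),
          KummerCore.toGeomPoints_mem_fixedGeomPoints (W.baseChange K) _ (bc R)⟩ := by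
    intro R
    have hfix : ∀ σ ∈ (⊤ : Subgroup (absoluteGaloisGroup K)),
        σ • toGeomPoints (W.baseChange K) R = toGeomPoints (W.baseChange K) R :=
      ((W.baseChange K).mem_fixedGeomPoints_iff _).1 (KummerCore.toGeomPoints_mem_fixedGeomPoints W ⊤ R)
    rw [IsKummerFamilyOver.eq_kummerFamily p
      ((W.baseChange K).smul_geomPointsMapOfEmb_of_fixed (closureEmb (K := K) (𝔭.adicCompletion K)) ⊤ hfix)
      (IsKummerFamilyOver.localTorsionResPi (W.baseChange K) (closureEmb (K := K) (𝔭.adicCompletion K))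
        p ⊤ hfix ((W.baseChange K).isKummerFamilyOver_kummerFamily p ⊤
          ⟨toGeomPoints (W.baseChange K) R, KummerCore.toGeomPoints_mem_fixedGeomPoints W ⊤ R⟩))]
    congr 1
    exact Subtype.ext (KummerCore.geomPointsMapOfEmb_toGeomPoints (W.baseChange K) _ R)
  have h0 := congrArg ((W.baseChange K).localTorsionResPi (closureEmb (K := K) (𝔭.adicCompletion K)) p ⊤) h2x
  rw [map_nsmul, hloc0, smul_zero, map_add, localTorsionResPi_padicPi, localTorsionResPi_padicPi,
    hmP, hmT, hlocfam PK, hlocfam T₂] at h0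
  have hαβ := hdet (bc PK) (bc T₂) α β h0.symm
  have e1 : Φ (bc PK) = (lam (W.toPadicPoint p P), 0) := hV1P
  have e2 : Φ (bc T₂) = (0, lam' (W'.toPadicPoint p P')) := hT₂
  rw [e1, e2, Prod.smul_mk, Prod.smul_mk, Prod.mk_add_mk, Prod.mk_eq_zero, smul_zero, smul_zero,
    add_zero, zero_add, smul_eq_mul, smul_eq_mul] at hαβ
  have hα : α = 0 := (mul_eq_zero.1 hαβ.1).resolve_right hx₁
  have hβ : β = 0 := (mul_eq_zero.1 hαβ.2).resolve_right hx₂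
  rw [hα, hβ, KummerCore.padicPi_zero_left, KummerCore.padicPi_zero_left, add_zero] at h2x
  exact (AddCommGroup.mem_torsion _).2 (isOfFinAddOrder_iff_nsmul_eq_zero.2 ⟨2, two_pos, h2x⟩)

/-- **S_dict′ IS A THEOREM at every prime: `X12.O11.RamifiedCMLocalMordellWeilDictAtZp W p` holds** for
every globally minimal `W/ℚ` and every prime `p` — the dictionary `m_loc = n + n'`
(`ramifiedCMLocalMordellWeilDictAt_holds`) together with the injectivity of `loc_𝔭` on `E(K) ⊗ ℤ_p`
modulo torsion (`mordellWeilKummerSpan_torsion_of_loc_torsion`, bottom layer `Γ_K`).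
[cite: SilvermanAEC2009, Prop. VII.6.3 and Exercise 10.16] [cite: PerrinRiou1987BSMF, §0 p. 401] -/
theorem ramifiedCMLocalMordellWeilDictAtZp_holds (W : WeierstrassCurve ℚ) [W.IsElliptic]
    [W.IsGloballyMinimal] (p : ℕ) [Fact p.Prime] : X12.O11.RamifiedCMLocalMordellWeilDictAtZp W p := by
  intro K _ _ 𝔭 W' _ _ C hF hr κ hκ P n P' n' hP hgen htors hdiv hndiv hP' hgen' htors' hdiv' hndiv'
  exact ⟨ramifiedCMLocalMordellWeilDictAt_holds W p K 𝔭 W' C hF hr κ hκ P n P' n' hP hgen htors hdiv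
    hndiv hP' hgen' htors' hdiv' hndiv',
    mordellWeilKummerSpan_torsion_of_loc_torsion W p hF hP hgen hP' hgen' (κ.layerSubgroup 0)
      (ZpExtension.layerSubgroup_zero κ)⟩

/-- **stub S_dict′** of the line `rubin-formula-zp` on crux `EllipticUnitValueSevenOfGZK`
(stmt-BirchSwinnertonDyer-19945): `m_loc = n + n'` ∧ (inj) at the ramified prime `7` for every globally
minimal `W ∈ 𝒞₇` — PROVED (the case `p = 7` of `ramifiedCMLocalMordellWeilDictAtZp_holds`; the class
hypothesis is not needed). Closes no item by itself; BSD is not claimed.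
[cite: SilvermanAEC2009, Prop. VII.6.3 and Exercise 10.16] -/
theorem stub_localMordellWeilDictSevenZp :
    ∀ (W : WeierstrassCurve ℚ) [W.IsElliptic] [W.IsGloballyMinimal] [Fact (Nat.Prime 7)],
      X12.ClassCSeven W → X12.O11.RamifiedCMLocalMordellWeilDictAtZp W 7 :=
  fun W _ _ _ _ ↦ ramifiedCMLocalMordellWeilDictAtZp_holds W 7

end Summit.BirchSwinnertonDyer.BirchSwinnertonDyer.Theorems.RamifiedSevenEllipticUnits

end
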